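import Mathlib
import Summits.KontsevichZagierPeriods.KontsevichZagierPeriods.Theorems.FermatIsogenyBetaLinearSectorQuartersStubLorentzDisc
import Summits.KontsevichZagierPeriods.KontsevichZagierPeriods.Theorems.K2SymbolChainsClausenPiVanishesDoubling
import HarnessLib

/-!
# `BetaLinearSector` (stmt-KontsevichZagierPeriods-3897), line `fermat-sector-transport` —
# stub `stub_arctanUnit_equivalent_lorentz` (Euler reflection at `1/6`, step 4b)

The level-6 rung of the crux `BetaLinearSector` (route FermatIsogeny) needs Euler's reflection at
`1/6` INSIDE the Kontsevich–Zagier calculus of moves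
(`Literature/NumberTheory/Transcendental/KZCalculus.lean`). This file is step 4b: the arctangent
cell `V = [(0,1), 4 dv/(1+v²)]` (value `π`) is equivalent (`KZ.Equivalent`) to the half-line
Lorentzian `L = [(0,∞), 2 du/(1+u²)]` (value `π`) — for ANY representations with the displayed
domains and integrands agreeing with the displayed ones on them.

## Proof

ONE change of variables (rule (2), `KZ.changeOfVariablesRel`) by the tangent double-angle map
`u = φ(v) = 2v/(1 − v²)` from `(0,1)` onto `(0,∞)` (`ℚ`-rational; `φ'(v) = 2(1+v²)/(1−v²)² > 0`,
the derivative lemma being the tree's `ClausenPi.hasDerivAt_sheet`; injective on `(0,1)` since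
`φ p = φ q` forces `(p − q)(1 + pq) = 0` with `pq > 0`; onto since `u = φ(u/(1 + √(1+u²)))` with
`u/(1+√(1+u²)) ∈ (0,1)` for `u > 0`), with the KEY IDENTITY `(1−v²)² + 4v² = (1+v²)²`, i.e.
`1 + φ(v)² = (1+v²)²/(1−v²)²`, so that the pull-back is EXACT:
`(2/(1+u²))∘φ · |φ'| = 2(1−v²)²/(1+v²)² · 2(1+v²)/(1−v²)² = 4/(1+v²)`.
Source `r = V`, target `r' = L`, both GIVEN (pinned by domain and integrand on it); the packaging is
the one-dimensional rule (2) `of_sub_of_mem_changeOfVariablesRel_dimOne`, exactly as in the level-4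
template `Quarters.lorentzDisc_equivalent_arctan` (Cayley map) and in
`CompiledSubstitutions.PiNormalisation.equivalent_of_tanDouble` (the same map on `(−1,1)`, whose
`one_sub_sq_pos` is reused). No definitions are introduced (the substitution and its derivative are
written out).

References: M. Kontsevich, D. Zagier, *Periods* (2001), §1.1 eq. (1), §1.2 rule (2).
-/

noncomputable section

namespace Summit.KontsevichZagierPeriods.FermatIsogeny.BetaLinearSector.Sixths

open Set MeasureTheory
open MvPolynomial (aeval X C)
open Literature.NumberTheory.Transcendental Literature.NumberTheory.Transcendental.KZ
open Summit.KontsevichZagierPeriods.HermiteRigidity.CMTwistQuasiPeriodTransfer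
  (of_sub_of_mem_changeOfVariablesRel_dimOne image_fin_one)
open Summit.KontsevichZagierPeriods.KontsevichZagierPeriods.Theorems.GKZLevelThree
  (isSemialgebraicFunOn_ratFun₁)
open Summit.KontsevichZagierPeriods.CompiledSubstitutions.PiNormalisation (one_sub_sq_pos)
open Summit.KontsevichZagierPeriods.K2SymbolChains.ClausenPi (hasDerivAt_sheet)

/-! ## The tangent double-angle substitution `u = 2v/(1−v²)` from `(0,1)` onto `(0,∞)` -/

/-- `(0,1) ⊆ (−1,1)` (to feed `one_sub_sq_pos`: `1 − v² > 0` on `(0,1)`). [folklore] -/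
theorem arctanUnit_mem_symIoo {v : ℝ} (hv : v ∈ Ioo (0:ℝ) 1) : v ∈ Ioo (-1:ℝ) 1 :=
  Ioo_subset_Ioo_left (by norm_num) hv

/-- `φ` sends `(0,1)` into `(0,∞)`. [folklore] -/
theorem arctanUnit_tanDouble_pos {v : ℝ} (hv : v ∈ Ioo (0:ℝ) 1) : 0 < 2 * v / (1 - v ^ 2) :=
  div_pos (by linarith [hv.1]) (one_sub_sq_pos (arctanUnit_mem_symIoo hv))

/-- `φ` sends `(0,1)` ONTO `(0,∞)`: `u = φ(u/(1 + √(1+u²)))`. [folklore] -/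
theorem arctanUnit_image_tanDouble :
    (fun v : ℝ => 2 * v / (1 - v ^ 2)) '' Ioo (0:ℝ) 1 = Ioi 0 := by
  apply Subset.antisymm
  · rintro _ ⟨v, hv, rfl⟩
    exact arctanUnit_tanDouble_pos hv
  · intro u hu
    have hu0 : (0:ℝ) < u := hu
    set w : ℝ := √(1 + u ^ 2) with hw
    have h1u : (0:ℝ) ≤ 1 + u ^ 2 := by positivity
    have hw0 : 0 ≤ w := Real.sqrt_nonneg _
    have hw2 : w ^ 2 = 1 + u ^ 2 := Real.sq_sqrt h1u
    have huw : u < w := by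
      rw [hw, Real.lt_sqrt hu0.le]
      linarith
    have h1w : (0:ℝ) < 1 + w := by linarith
    refine ⟨u / (1 + w), ⟨div_pos hu0 h1w, ?_⟩, ?_⟩
    · rw [div_lt_one h1w]
      linarith
    · have hu2 : u ^ 2 = (w - 1) * (1 + w) := by linear_combination (-1 : ℝ) * hw2
      have hden : 1 - (u / (1 + w)) ^ 2 = 2 / (1 + w) := by
        rw [div_pow, hu2]
        field_simp
        ring
      show 2 * (u / (1 + w)) / (1 - (u / (1 + w)) ^ 2) = u
      rw [hden]
      field_simp

/-- `φ` is injective on `(0,1)`: `φ p = φ q` forces `(p − q)(1 + pq) = 0`, and `pq > 0`.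
[folklore] -/
theorem arctanUnit_tanDouble_inj {p q : ℝ} (hp : p ∈ Ioo (0:ℝ) 1) (hq : q ∈ Ioo (0:ℝ) 1)
    (h : 2 * p / (1 - p ^ 2) = 2 * q / (1 - q ^ 2)) : p = q := by
  rw [div_eq_div_iff (one_sub_sq_pos (arctanUnit_mem_symIoo hp)).ne'
    (one_sub_sq_pos (arctanUnit_mem_symIoo hq)).ne'] at h
  have h1 : (p - q) * (1 + p * q) = 0 := by linear_combination h / 2
  have hpq : 0 < p * q := mul_pos hp.1 hq.1
  rcases mul_eq_zero.1 h1 with h2 | h2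
  · linarith
  · linarith

/-- The pull-back identity of the substitution, Jacobian included:
`2/(1 + φ(v)²) · (2(1+v²)/(1−v²)²) = 4/(1+v²)` on `(0,1)` (`1 + φ(v)² = (1+v²)²/(1−v²)²`, i.e.
`(1−v²)² + 4v² = (1+v²)²`). [folklore] -/
theorem arctanUnit_tanDouble_pullback {v : ℝ} (hv : v ∈ Ioo (0:ℝ) 1) :
    2 / (1 + (2 * v / (1 - v ^ 2)) ^ 2) * (2 * (1 + v ^ 2) / (1 - v ^ 2) ^ 2) =
      4 / (1 + v ^ 2) := by
  have hpos : (0:ℝ) < 1 + v ^ 2 := by positivity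
  have hmv : (0:ℝ) < 1 - v ^ 2 := one_sub_sq_pos (arctanUnit_mem_symIoo hv)
  have hsq : 1 + (2 * v / (1 - v ^ 2)) ^ 2 = ((1 + v ^ 2) / (1 - v ^ 2)) ^ 2 := by
    field_simp
    ring
  rw [hsq]
  field_simp
  ring

/-- **The new move** (rule (2)): for any representation `V` with domain the cell `(0,1)` and
integrand `4/(1+v²)` on it, and any representation `L` with domain the half-line `(0,∞)` and
integrand `2/(1+u²)` on it, the tangent double-angle substitution `u = 2v/(1−v²)` gives
`[V] − [L] ∈ KZ.changeOfVariablesRel ⊆ KZ.relations`, i.e. `V ∼ L`.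
[cite: KontsevichZagier2001, §1.2 rule (2)] -/
theorem arctanUnit_equivalent_lorentz (V L : IntegralRep 1)
    (hVd : V.domain = {x | x 0 ∈ Set.Ioo (0:ℝ) 1})
    (hVi : EqOn V.integrand (fun x => 4 / (1 + (x 0) ^ 2)) V.domain)
    (hLd : L.domain = {x | 0 < x 0})
    (hLi : EqOn L.integrand (fun x => 2 / (1 + (x 0) ^ 2)) L.domain) : Equivalent V L := by
  set φ : ℝ → ℝ := fun v => 2 * v / (1 - v ^ 2) with hφ
  set φ' : ℝ → ℝ := fun v => 2 * (1 + v ^ 2) / (1 - v ^ 2) ^ 2 with hφ'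
  have hmem : ∀ p ∈ V.domain, p 0 ∈ Ioo (0:ℝ) 1 := fun p hp => by rw [hVd] at hp; exact hp
  have hmem' : ∀ p ∈ V.domain, (0:ℝ) < 1 - p 0 ^ 2 := fun p hp =>
    one_sub_sq_pos (arctanUnit_mem_symIoo (hmem p hp))
  refine changeOfVariablesRel_subset_relations
    (of_sub_of_mem_changeOfVariablesRel_dimOne V L φ φ' ?_
      (fun p hp => hasDerivAt_sheet (hmem' p hp).ne') ?_ ?_ ?_)
  · refine isSemialgebraicFunOn_ratFun₁ V.isSemialgebraic_domain (C 2 * X 0) (1 - X 0 ^ 2) φ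
      (fun x hx => ?_) (fun x _ => ?_)
    · simp only [map_sub, map_one, map_pow, MvPolynomial.aeval_X]
      exact (hmem' x hx).ne'
    · simp [hφ]
  · intro p hp q hq h
    exact arctanUnit_tanDouble_inj (hmem p hp) (hmem q hq) h
  · rw [hLd, hVd]
    exact (image_fin_one (S := Ioo 0 1) arctanUnit_image_tanDouble).symm
  · intro p hp
    have hp' : p 0 ∈ Ioo (0:ℝ) 1 := hmem p hp
    have hpos : 0 < φ' (p 0) := by
      have : (0:ℝ) < 1 - p 0 ^ 2 := hmem' p hp
      simp only [hφ']
      positivity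
    have hφp : (fun _ : Fin 1 => φ (p 0)) ∈ L.domain := by
      rw [hLd]
      exact arctanUnit_tanDouble_pos hp'
    rw [hVi hp, hLi hφp, abs_of_pos hpos]
    exact (arctanUnit_tanDouble_pullback hp').symm

/-! ## The stub -/

/-- **Step 4b of Euler's reflection at `1/6`** (line `fermat-sector-transport` of
`BetaLinearSector`): the arctangent cell `[(0,1), 4/(1+v²)]` (value `π`) is `KZ.Equivalent` to the
half-line Lorentzian `[(0,∞), 2/(1+u²)]` (value `π`), for any representations with these domains
and integrands agreeing with the displayed ones on them — ONE change of variables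
`u = 2v/(1−v²)` (`arctanUnit_equivalent_lorentz`). [cite: KontsevichZagier2001, §1.2 rule (2)] -/
theorem stub_arctanUnit_equivalent_lorentz : ∀ (V L : KZ.IntegralRep 1),
    V.domain = {x | x 0 ∈ Set.Ioo (0:ℝ) 1} →
    Set.EqOn V.integrand (fun x => 4 / (1 + (x 0) ^ 2)) V.domain →
    L.domain = {x | 0 < x 0} → Set.EqOn L.integrand (fun x => 2 / (1 + (x 0) ^ 2)) L.domain →
    KZ.Equivalent V L :=
  fun V L hVd hVi hLd hLi => arctanUnit_equivalent_lorentz V L hVd hVi hLd hLi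

end Summit.KontsevichZagierPeriods.FermatIsogeny.BetaLinearSector.Sixths

end
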